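import Summits.QuantumFields.YangMills.Theorems.LuscherReductionTwistedTraceScalingBOStiffSepLinear
import Summits.QuantumFields.YangMills.Theorems.LuscherReductionTwistedTraceScalingBOStiffSepJumps
import Summits.QuantumFields.YangMills.Theorems.LuscherReductionTwistedTraceScalingGaugeActionLinear
import Summits.QuantumFields.YangMills.Theorems.LuscherReductionTwistedTraceScalingVacuumHodge
import Summits.QuantumFields.YangMills.Theorems.LuscherReductionOneSiteLevelsValleyAlgebra
import Summits.QuantumFields.YangMills.Theorems.LuscherReductionTwistedTraceScalingBOFibreBall
import HarnessLib

/-!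
# (C5-α, L-a/L-b) STIFF SEPARATION, THE LINK-SPACE IDENTITY: `x' − x + D_uζ₀ − κ = Y` with `κ` a constant mode and `‖Y‖ ≤ √6·d + √(6|E|)·(ρ₂ + 4ρ_B m)`
# (lane A of S-BASE, crux `TwistedTraceScaling` stmt-QuantumFields-20203, C4-CORE, the (OD) pen; §4 of `pub/ym-fleet/ym-luscher-20007-p1/Lines-stiff-separation.md`)

Two tube points `U' = oT u' x'`, `V = oT u x` and a small gauge parameter `ζ` (`η = chartSU2∘ζ`, `W = V^η = covRel u ζ x · constLift u`): if `kinDefect U' V η ≤ d²` then, link by link,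
the transverse coordinate of `U'` equals the linear prediction `x_e − (D_uζ₀)_e` (`ζ₀ = ζ − ζ̄`) plus the vector part of the slow mismatch `δ_k = u_k u'_k⁻¹` (a CONSTANT mode) plus an
error of size `‖q(U'_e) − q(W_e)‖ + ρ₂ + 4ρ_B m` (`ρ₂` the linearisation error of `…BOStiffSepLinear`, `ρ_B ≥ ‖q(covRel_e) − 1‖`, `m ≥ ‖q(δ_k) − 1‖`).  No chart of `W` is taken.
* §1 `abs_vecPart_sub_sub_vecPart_le` — four unit quaternions: `|P⃗_c − B⃗_c − (ba⁻¹)⃗_c| ≤ ‖q(P)q(a) − q(B)q(b)‖ + 4‖q(B) − 1‖‖q(ba⁻¹) − 1‖`;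
* §2 ★ `stiffSep_link_bound` — the per-link bound above;
* §3 ★★ `stiffSep_linkSpace_bound` — in `LinkSpace L`: `‖linkEmbed x' − linkEmbed x + covGradL u ζ₀ − κ‖ ≤ √6·d + √(6|E|)·(ρ₂ + 4ρ_B m)`, `κ ∈ constModes L` (`constLink_mem_constModes`).
HONEST FRAMING: algebra for a stub of a child of the CONDITIONAL route R2b1; (SEP) bootstrap/projections and the hOD assembly, (B-ST), C4-CORE OPEN; not a gap, not Clay.
-/

set_option autoImplicit false

noncomputable section

open MeasureTheory Filter Topology Real
open scoped BigOperators Matrix Quaternion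
open Literature.MathematicalPhysics.QuantumFieldTheory
open Literature.MathematicalPhysics.QuantumLattice

namespace Summit.QuantumFields.YangMills.Theorems.FemtoTransferGap.TwoLattice.ConstTube

open Summit.QuantumFields.YangMills.Theorems.FemtoTransferGap
open Summit.QuantumFields.YangMills.Theorems.FemtoTransferGap.TwoLattice
open Summit.QuantumFields.YangMills.Theorems.FemtoTransferGap.TwoLattice.Avg
open Summit.QuantumFields.YangMills.Theorems.FemtoTransferGap.TwoLattice.Stiff

variable {L : ℕ} [NeZero L]

/-! ## §1 Four unit quaternions -/

omit [NeZero L] in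
/-- For `A : SU2` and a component `c`: `|A⃗_c| ≤ ‖A⃗‖∞`. [folklore] -/
theorem abs_vecPart_apply_le_norm (A : SU2) (c : Fin 3) : |vecPart A c| ≤ ‖vecPart A‖ := by
  rw [← Real.norm_eq_abs]; exact norm_le_pi_norm _ c

omit [NeZero L] in
/-- ★ `|P⃗_c − B⃗_c − (ba⁻¹)⃗_c| ≤ ‖q(P)q(a) − q(B)q(b)‖ + 4‖q(B) − 1‖·‖q(ba⁻¹) − 1‖` for unit quaternions `P, B, a, b`. [folklore] -/
theorem abs_vecPart_sub_sub_vecPart_le (P B a b : SU2) (c : Fin 3) :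
    |vecPart P c - vecPart B c - vecPart (b * a⁻¹) c| ≤ ‖su2Quat P * su2Quat a - su2Quat B * su2Quat b‖ + 4 * ‖su2Quat B - 1‖ * ‖su2Quat (b * a⁻¹) - 1‖ := by
  have hmul := @Literature.MathematicalPhysics.QuantumFieldTheory.Balaban1983to89.T4HaarSU2Translate.su2Quat_mul
  set δ : SU2 := b * a⁻¹ with hδ
  -- `‖q(P) − q(Bδ)‖ = ‖q(P)q(a) − q(B)q(b)‖`
  have e1 : ‖su2Quat P - su2Quat (B * δ)‖ = ‖su2Quat P * su2Quat a - su2Quat B * su2Quat b‖ := by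
    have h : (su2Quat P - su2Quat (B * δ)) * su2Quat a = su2Quat P * su2Quat a - su2Quat B * su2Quat b := by
      rw [sub_mul, ← hmul (B * δ) a, hδ, show B * (b * a⁻¹) * a = B * b by group, hmul]
    rw [← h, norm_mul, norm_su2Quat, mul_one]
  -- vector part of a product
  have hv : vecPart (B * δ) = scalarPart B • vecPart δ + scalarPart δ • vecPart B + vecPart B ⨯₃ vecPart δ := vecPart_mul B δ
  have hdec : vecPart P c - vecPart B c - vecPart δ c = (vecPart P c - vecPart (B * δ) c) +
      ((scalarPart B - 1) * vecPart δ c + (scalarPart δ - 1) * vecPart B c + (vecPart B ⨯₃ vecPart δ) c) := by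
    rw [hv]; simp only [Pi.add_apply, Pi.smul_apply, smul_eq_mul]; ring
  have h1 : |vecPart P c - vecPart (B * δ) c| ≤ ‖su2Quat P * su2Quat a - su2Quat B * su2Quat b‖ := by rw [← e1]; exact abs_vecPart_sub_le P (B * δ) c
  have hsB : 0 ≤ 1 - scalarPart B ∧ 1 - scalarPart B ≤ ‖su2Quat B - 1‖ := ⟨by linarith [scalarPart_le_one B], one_sub_scalarPart_le_norm_sub_one B⟩
  have hsδ : 0 ≤ 1 - scalarPart δ ∧ 1 - scalarPart δ ≤ ‖su2Quat δ - 1‖ := ⟨by linarith [scalarPart_le_one δ], one_sub_scalarPart_le_norm_sub_one δ⟩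
  have hvB : ‖vecPart B‖ ≤ ‖su2Quat B - 1‖ := norm_vecPart_le_norm_sub_one B
  have hvδ : ‖vecPart δ‖ ≤ ‖su2Quat δ - 1‖ := norm_vecPart_le_norm_sub_one δ
  have h2 : |(scalarPart B - 1) * vecPart δ c| ≤ ‖su2Quat B - 1‖ * ‖su2Quat δ - 1‖ := by
    rw [abs_mul, show |scalarPart B - 1| = 1 - scalarPart B by rw [abs_sub_comm]; exact abs_of_nonneg hsB.1]
    exact mul_le_mul hsB.2 ((abs_vecPart_apply_le_norm δ c).trans hvδ) (abs_nonneg _) (norm_nonneg _)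
  have h3 : |(scalarPart δ - 1) * vecPart B c| ≤ ‖su2Quat B - 1‖ * ‖su2Quat δ - 1‖ := by
    rw [abs_mul, show |scalarPart δ - 1| = 1 - scalarPart δ by rw [abs_sub_comm]; exact abs_of_nonneg hsδ.1, mul_comm]
    exact mul_le_mul ((abs_vecPart_apply_le_norm B c).trans hvB) hsδ.2 hsδ.1 (norm_nonneg _)
  have h4 : |(vecPart B ⨯₃ vecPart δ) c| ≤ 2 * (‖su2Quat B - 1‖ * ‖su2Quat δ - 1‖) := by
    have h := norm_cross_le_two (vecPart B) (vecPart δ)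
    have hc : |(vecPart B ⨯₃ vecPart δ) c| ≤ ‖vecPart B ⨯₃ vecPart δ‖ := by rw [← Real.norm_eq_abs]; exact norm_le_pi_norm _ c
    exact hc.trans (h.trans (mul_le_mul_of_nonneg_left (mul_le_mul hvB hvδ (norm_nonneg _) (norm_nonneg _)) (by norm_num)))
  rw [hdec]
  calc |vecPart P c - vecPart (B * δ) c + ((scalarPart B - 1) * vecPart δ c + (scalarPart δ - 1) * vecPart B c + (vecPart B ⨯₃ vecPart δ) c)|
      ≤ |vecPart P c - vecPart (B * δ) c| + (|(scalarPart B - 1) * vecPart δ c| + |(scalarPart δ - 1) * vecPart B c| + |(vecPart B ⨯₃ vecPart δ) c|) :=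
        (abs_add_le _ _).trans (add_le_add le_rfl ((abs_add_le _ _).trans (add_le_add (abs_add_le _ _) le_rfl)))
    _ ≤ _ := by linarith

/-! ## §2 ★ The per-link bound -/

omit [NeZero L] in
/-- A gauge parameter with `‖ζ_y‖∞ ≤ G ≤ 1/40` lies in the unit ball (needed by `gaugeTransform_orthoTube_eq`). [folklore] -/
theorem sum_sq_le_one_of_norm_le {ζ : Site 3 L → Fin 3 → ℝ} {G : ℝ} (hG : ∀ y, ‖ζ y‖ ≤ G) (hG1 : G ≤ 1 / 40) (y : Site 3 L) : ∑ a, ζ y a ^ 2 ≤ 1 := by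
  have h3 := sum_sq_le_three_norm_sq (ζ y)
  have hy : ‖ζ y‖ ≤ 1 / 40 := (hG y).trans hG1
  nlinarith [norm_nonneg (ζ y)]

section Link

variable {u u' : GaugeConfig 3 1 SU2} {ζ : Site 3 L → Fin 3 → ℝ} {x x' : Edge 3 L → Fin 3 → ℝ} {G Gm ω τ ρB m : ℝ}
  (hG : ∀ y, ‖ζ y‖ ≤ G) (hω : ∀ e, ‖x e‖ ≤ ω) (hG1 : G ≤ 1 / 40) (hω1 : ω ≤ 1 / 20)
  (hτ1 : τ ≤ 1) (hu : ∀ (k : Fin 3) (c : Fin 3), |vecPart (u (0, k)) c| ≤ τ) (hGm : ‖siteMean L ζ‖ ≤ Gm)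
  (hbal : ∀ (k : Fin 3) (a : Fin 3), ∑ y : Site 3 L, x (y, k) a = 0) (hx' : ∀ e, ∑ a, x' e a ^ 2 ≤ 1)
  (hB : ∀ e, ‖su2Quat (covRel L u ζ x e) - 1‖ ≤ ρB) (hm : ∀ k : Fin 3, ‖su2Quat (u (0, k) * (u' (0, k))⁻¹) - 1‖ ≤ m)

include hG hω hG1 hω1 hτ1 hu hGm hx' hB hm

/-- ★ **PER-LINK STIFF-SEPARATION BOUND**: with `W = (oT u x)^{chartSU2∘ζ}`, `ζ₀ = ζ − ζ̄`, `δ_k = u_k u'_k⁻¹`: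
`|x'_{e,c} − (x_{e,c} − (D_uζ₀)_{e,c}) − (δ_k)⃗_c| ≤ ‖q(oT u' x' e) − q(W e)‖ + (40(4G² + 2Gω) + 12τG_m) + 4ρ_B m`. [folklore] -/
theorem stiffSep_link_bound (e : Edge 3 L) (c : Fin 3) :
    |x' e c - (x e c - covGrad L u (fun y => ζ y - siteMean L ζ) e c) - vecPart (u (0, e.2) * (u' (0, e.2))⁻¹) c| ≤
      ‖su2Quat (orthoTube L u' x' e) - su2Quat (gaugeTransform (fun y => chartSU2 (ζ y)) (orthoTube L u x) e)‖ +
        (40 * (4 * G ^ 2 + 2 * G * ω) + 12 * τ * Gm) + 4 * ρB * m := by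
  have hmul := @Literature.MathematicalPhysics.QuantumFieldTheory.Balaban1983to89.T4HaarSU2Translate.su2Quat_mul
  have hζ1 : ∀ y, ∑ a, ζ y a ^ 2 ≤ 1 := sum_sq_le_one_of_norm_le hG hG1
  -- the two links as products
  have hW : gaugeTransform (fun y => chartSU2 (ζ y)) (orthoTube L u x) e = covRel L u ζ x e * u (0, e.2) := by
    rw [gaugeTransform_orthoTube_eq L u ζ x hζ1, Pi.mul_apply, constLift_apply]
  have hU : orthoTube L u' x' e = chartSU2 (x' e) * u' (0, e.2) := rfl
  rw [hW, hU, hmul, hmul]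
  -- the abstract four-quaternion bound
  have h4 := abs_vecPart_sub_sub_vecPart_le (chartSU2 (x' e)) (covRel L u ζ x e) (u' (0, e.2)) (u (0, e.2)) c
  rw [vecPart_chartSU2 (hx' e)] at h4
  -- the linearisation of `vecPart (covRel …)`
  have hlin := norm_vecPart_covRel_sub_linear_le_mean hG hω hG1 hω1 hτ1 hu hGm e
  have hlin' : x e - covGrad L u (fun y => ζ y - siteMean L ζ) e = x e + (ζ e.1 - siteMean L ζ) - (adRot (u (0, e.2))).mulVec (ζ (e.1.shift e.2) - siteMean L ζ) := by
    simp only [covGrad]; abel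
  have hlc : |vecPart (covRel L u ζ x e) c - (x e c - covGrad L u (fun y => ζ y - siteMean L ζ) e c)| ≤ 40 * (4 * G ^ 2 + 2 * G * ω) + 12 * τ * Gm := by
    have h := norm_le_pi_norm (vecPart (covRel L u ζ x e) - (x e + (ζ e.1 - siteMean L ζ) - (adRot (u (0, e.2))).mulVec (ζ (e.1.shift e.2) - siteMean L ζ))) c
    rw [Real.norm_eq_abs, Pi.sub_apply] at h
    have e2 : (x e + (ζ e.1 - siteMean L ζ) - (adRot (u (0, e.2))).mulVec (ζ (e.1.shift e.2) - siteMean L ζ)) c = x e c - covGrad L u (fun y => ζ y - siteMean L ζ) e c := by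
      rw [← hlin']; rfl
    rw [e2] at h
    exact h.trans hlin
  have hBm : 4 * ‖su2Quat (covRel L u ζ x e) - 1‖ * ‖su2Quat (u (0, e.2) * (u' (0, e.2))⁻¹) - 1‖ ≤ 4 * ρB * m := by
    have := mul_le_mul (hB e) (hm e.2) (norm_nonneg _) ((norm_nonneg _).trans (hB e))
    linarith
  -- combine
  have e3 : x' e c - (x e c - covGrad L u (fun y => ζ y - siteMean L ζ) e c) - vecPart (u (0, e.2) * (u' (0, e.2))⁻¹) c =
      (x' e c - vecPart (covRel L u ζ x e) c - vecPart (u (0, e.2) * (u' (0, e.2))⁻¹) c) +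
        (vecPart (covRel L u ζ x e) c - (x e c - covGrad L u (fun y => ζ y - siteMean L ζ) e c)) := by ring
  rw [e3]
  exact (abs_add_le _ _).trans (by linarith)

/-! ## §3 ★★ The link-space bound -/

/-- ★★ **THE LINK-SPACE IDENTITY WITH A CONSTANT MODE**: with `κ := (e,c) ↦ (u_k u'_k⁻¹)⃗_c` (`∈ constModes L`) and `kinDefect (oT u' x') (oT u x) (chartSU2∘ζ) ≤ d²` (`d ≥ 0`):
`‖linkEmbed x' − linkEmbed x + covGradL u ζ₀ − κ‖ ≤ √6·d + √(6|E|)·((40(4G² + 2Gω) + 12τG_m) + 4ρ_B m)`. [folklore] -/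
theorem stiffSep_linkSpace_bound {d : ℝ} (hd : 0 ≤ d) (hK : kinDefect L (orthoTube L u' x') (orthoTube L u x) (fun y => chartSU2 (ζ y)) ≤ d ^ 2) :
    ‖linkEmbed L x' - linkEmbed L x + covGradL L u (fun y => ζ y - siteMean L ζ) -
        (WithLp.toLp 2 fun ea : Edge 3 L × Fin 3 => (fun (c : Fin 3) (k : Fin 3) => vecPart (u (0, k) * (u' (0, k))⁻¹) c) ea.2 ea.1.2)‖ ≤
      Real.sqrt 6 * d + Real.sqrt (6 * Fintype.card (Edge 3 L)) * ((40 * (4 * G ^ 2 + 2 * G * ω) + 12 * τ * Gm) + 4 * ρB * m) := by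
  set A : ℝ := (40 * (4 * G ^ 2 + 2 * G * ω) + 12 * τ * Gm) + 4 * ρB * m with hA
  set Y : LinkSpace L := linkEmbed L x' - linkEmbed L x + covGradL L u (fun y => ζ y - siteMean L ζ) -
    (WithLp.toLp 2 fun ea : Edge 3 L × Fin 3 => (fun (c : Fin 3) (k : Fin 3) => vecPart (u (0, k) * (u' (0, k))⁻¹) c) ea.2 ea.1.2) with hY
  set Δ : Edge 3 L → ℝ := fun e => ‖su2Quat (orthoTube L u' x' e) - su2Quat (gaugeTransform (fun y => chartSU2 (ζ y)) (orthoTube L u x) e)‖ with hΔ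
  have hΔe : ∀ e, Δ e = ‖su2Quat (orthoTube L u' x' e) - su2Quat (gaugeTransform (fun y => chartSU2 (ζ y)) (orthoTube L u x) e)‖ := fun e => by rw [hΔ]
  have hYc : ∀ (e : Edge 3 L) (c : Fin 3), |Y (e, c)| ≤ Δ e + A := by
    intro e c
    have h := stiffSep_link_bound hG hω hG1 hω1 hτ1 hu hGm hx' hB hm e c
    have eY : Y (e, c) = x' e c - (x e c - covGrad L u (fun y => ζ y - siteMean L ζ) e c) - vecPart (u (0, e.2) * (u' (0, e.2))⁻¹) c := by
      rw [hY, PiLp.sub_apply, PiLp.add_apply, PiLp.sub_apply, linkEmbed_apply, linkEmbed_apply, covGradL_apply, PiLp.toLp_apply]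
      simp only [covGrad, Pi.sub_apply]; ring
    rw [eY, hA, hΔe]; linarith [h]
  have hA0 : 0 ≤ A := by
    have hτ0 : 0 ≤ τ := (abs_nonneg _).trans (hu 0 0)
    have hG0 : 0 ≤ G := (norm_nonneg _).trans (hG 0)
    have hω0 : 0 ≤ ω := (norm_nonneg _).trans (hω ((0 : Site 3 L), (0 : Fin 3)))
    have hGm0 : 0 ≤ Gm := (norm_nonneg _).trans hGm
    have hρB0 : 0 ≤ ρB := (norm_nonneg _).trans (hB ((0 : Site 3 L), (0 : Fin 3)))
    have hm0 : 0 ≤ m := (norm_nonneg _).trans (hm 0)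
    rw [hA]; positivity
  -- sum of squares
  have hsum : ‖Y‖ ^ 2 ≤ 6 * d ^ 2 + 6 * Fintype.card (Edge 3 L) * A ^ 2 := by
    rw [EuclideanSpace.norm_sq_eq, Fintype.sum_prod_type]
    have hKΔ : ∑ e : Edge 3 L, Δ e ^ 2 ≤ d ^ 2 := by
      refine le_trans (le_of_eq ?_) hK
      unfold kinDefect
      refine Finset.sum_congr rfl fun e _ => ?_
      rw [hΔe, show gaugeTransform (fun y => chartSU2 (ζ y)) (orthoTube L u x) e = chartSU2 (ζ e.1) * orthoTube L u x e * (chartSU2 (ζ (e.1.shift e.2)))⁻¹ from rfl,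
        norm_su2Quat_sub_gauge_link]
    calc ∑ e : Edge 3 L, ∑ c : Fin 3, ‖Y (e, c)‖ ^ 2 ≤ ∑ e : Edge 3 L, ∑ _c : Fin 3, (2 * Δ e ^ 2 + 2 * A ^ 2) := by
          refine Finset.sum_le_sum fun e _ => Finset.sum_le_sum fun c _ => ?_
          rw [Real.norm_eq_abs]
          have h := hYc e c
          have hΔ0 : 0 ≤ Δ e := norm_nonneg _
          have h1 : |Y (e, c)| ^ 2 ≤ (Δ e + A) ^ 2 := pow_le_pow_left₀ (abs_nonneg _) h 2
          nlinarith [sq_nonneg (Δ e - A)]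
      _ = ∑ e : Edge 3 L, (6 * Δ e ^ 2 + 6 * A ^ 2) :=
          Finset.sum_congr rfl fun e _ => by simp only [Finset.sum_const, Finset.card_univ, Fintype.card_fin, nsmul_eq_mul]; push_cast; ring
      _ = 6 * ∑ e : Edge 3 L, Δ e ^ 2 + 6 * Fintype.card (Edge 3 L) * A ^ 2 := by
          rw [Finset.sum_add_distrib, Finset.sum_const, Finset.card_univ, nsmul_eq_mul, ← Finset.mul_sum]; ring
      _ ≤ _ := by nlinarith
  have hY0 : 0 ≤ ‖Y‖ := norm_nonneg _
  have hrhs0 : 0 ≤ Real.sqrt 6 * d + Real.sqrt (6 * Fintype.card (Edge 3 L)) * A := by positivity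
  have hsq : (Real.sqrt 6 * d + Real.sqrt (6 * Fintype.card (Edge 3 L)) * A) ^ 2 ≥ 6 * d ^ 2 + 6 * Fintype.card (Edge 3 L) * A ^ 2 := by
    have h6 : Real.sqrt 6 ^ 2 = 6 := Real.sq_sqrt (by norm_num)
    have h6E : Real.sqrt (6 * Fintype.card (Edge 3 L)) ^ 2 = 6 * Fintype.card (Edge 3 L) := Real.sq_sqrt (by positivity)
    nlinarith [Real.sqrt_nonneg 6, Real.sqrt_nonneg (6 * (Fintype.card (Edge 3 L) : ℝ)), mul_nonneg (mul_nonneg (Real.sqrt_nonneg 6) hd)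
      (mul_nonneg (Real.sqrt_nonneg (6 * (Fintype.card (Edge 3 L) : ℝ))) hA0)]
  exact (pow_le_pow_iff_left₀ hY0 hrhs0 two_ne_zero).mp (hsum.trans hsq)

end Link

end Summit.QuantumFields.YangMills.Theorems.FemtoTransferGap.TwoLattice.ConstTube

end
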